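import Summits.ABC.ABC.Theorems.DefiniteXiEisensteinQuarantineForcedPairOccurrence
import Summits.ABC.ABC.Theorems.EisensteinQuarantine.Negative.EisensteinQuarantineFalseOfForcedPairDegreeDepthLaw
import Literature.NumberTheory.Automorphic.BrandtWeightedPairing
import Literature.NumberTheory.Automorphic.BrandtModuleWeightSymmProofs
import HarnessLib

/-!
# Stub-ideation k3 (family 3) — helper-lemma statements for `stub_forcedPairOccurrence`
(crux stmt-ABC-15023 `EisensteinQuarantine`, line `forced_pair_dlog`).  Elaboration sanity only:
every `sorry` below is a proposed ONE-CYCLE helper; `Stub` is the registered stub signature verbatim.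
-/

set_option linter.dupNamespace false

noncomputable section

open scoped BigOperators Matrix
open Literature.NumberTheory.Automorphic Literature.NumberTheory.EllipticCurves
open Summit.ABC.ABC.Theorems Summit.ABC.ABC.Theorems.EisensteinQuarantine.Negative

namespace Summit.ABC.ABC.Cruxes.EisensteinQuarantine.ForcedPairDlog.StubIdeas3

/-- The Frey `a`-sequence at the Legendre point `(−ℓ, ℓ−1)`. -/
abbrev aE (ℓ : ℕ) : ℕ → ℤ := fun n => (freyCurve (-(ℓ : ℤ)) ((ℓ - 1 : ℕ) : ℤ)).LFunction n

/-- The registered stub `stub_forcedPairOccurrence`, verbatim. -/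
def Stub : Prop :=
  ∃ c : ℕ, ∀ q ℓ : ℕ, q.Prime → ℓ.Prime → q ≠ 2 → 32 * q ∣ ℓ - 1 →
    ∀ N : ℕ, (freyCurve (-(ℓ : ℤ)) ((ℓ - 1 : ℕ) : ℤ)).conductorNorm ℤ = N →
    ∀ (S : Brandt.XiSetup (N / ℓ) ℓ) [Fintype (Brandt.ClassSet S.O)],
      ∀ φ : Brandt.ClassSet S.O → ℤ, φ ≠ 0 →
        Brandt.eigenLattice (N / ℓ * ℓ) (Brandt.matrix S.O)
            (fun n => (freyCurve (-(ℓ : ℤ)) ((ℓ - 1 : ℕ) : ℤ)).LFunction n) = ℤ ∙ φ →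
        ∃ ψ : Brandt.ClassSet S.O → ℤ,
          ∑ i, (Brandt.weight S.O i : ℤ) * ψ i * φ i = 0 ∧
            ∀ i, ((2 ^ ((q - 1).factorization 2 - c) : ℕ) : ℤ) ∣ φ i - ψ i

/-! ## Plan A — currency loop: the stub IS `ForcedPairDepthLaw`; kernel = `ForcedPairDegreeDepthLaw` -/

/-- **H1** (one cycle): the `brandtXi` depth law gives the stub for EVERY setup and eigen-line
(`Brandt.XiSetup.brandtXi_eq_xi` setup independence; `2^j ≤ 2^c · ordProj[2] x ⇒ 2^{j-c} ∣ x`;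
then `forcedPairOccurrence_of_dvd_xi`, p132787).  With the skeleton's `forcedPairDepthLaw_of_occurrence`
this makes `Stub ↔ ForcedPairDepthLaw`. -/
theorem stub_of_forcedPairDepthLaw (h : ForcedPairDepthLaw) : Stub := by
  sorry

/-- **H2** (one line after H1): the DEGREE-side law + Takahashi (named fact, true in print) + `FreyModularity`
(item stmt-ABC-11340) give the stub (`forcedPairDepthLaw_of_degreeDepthLaw`, p135429). -/
theorem stub_of_degreeDepthLaw (hT : takahashi2001_thm_2_3)
    (hMod : Summit.ABC.ABC.Theses.DefiniteXi.FreyModularity) (hD : ForcedPairDegreeDepthLaw) : Stub :=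
  stub_of_forcedPairDepthLaw (forcedPairDepthLaw_of_degreeDepthLaw hT hMod hD)

/-- Arithmetic glue used in H1: a power-of-two inequality against `ordProj[2]` is a divisibility. -/
theorem two_pow_sub_dvd_of_le_ordProj {j c x : ℕ} (h : 2 ^ j ≤ 2 ^ c * ordProj[2] x) :
    2 ^ (j - c) ∣ x := by
  sorry

/-! ## Plan B — Hecke-boundary (coinvariant) criterion: `φ ∈ I_E·M + 2^k M ⇒` occurrence mod `2^k` -/

/-- **H3** (one cycle, pure algebra): for a family of `w`-self-adjoint integer matrices with common
eigenvector `φ`, if `φ` is a HECKE BOUNDARY modulo `m` — `φ = Σ_{p∈s} (T_p − λ_p) y_p + m z` — then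
`ψ := φ − m z` is `w`-orthogonal to `φ` (`wpair_mulVec`) and `ψ ≡ φ (mod m)`. -/
theorem occurrence_of_heckeBoundary {ι : Type*} [Fintype ι] {P : Type*} (w : ι → ℕ)
    (T : P → Matrix ι ι ℤ) (lam : P → ℤ)
    (hT : ∀ p i j, (w i : ℤ) * T p i j = (w j : ℤ) * T p j i)
    {φ : ι → ℤ} (hφ : ∀ p, T p *ᵥ φ = lam p • φ)
    (m : ℤ) (s : Finset P) (y : P → ι → ℤ) (z : ι → ℤ)
    (h : φ = ∑ p ∈ s, (T p *ᵥ y p - lam p • y p) + m • z) :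
    ∃ ψ : ι → ℤ, ∑ i, (w i : ℤ) * ψ i * φ i = 0 ∧ ∀ i, m ∣ φ i - ψ i := by
  sorry

/-- **K_B** (research kernel of Plan B, strictly stronger than the stub; equal to it when the coinvariant
module `ℤ[Cls O]/I_E ℤ[Cls O]` is torsion-free at 2, as in Mazur–Emerton's prime-level Eisenstein case):
at forced pairs the Frey vector is a Hecke boundary modulo `2^{v₂(q−1)−c}`. -/
def FreyHeckeBoundaryDepth : Prop :=
  ∃ c : ℕ, ∀ q ℓ : ℕ, q.Prime → ℓ.Prime → q ≠ 2 → 32 * q ∣ ℓ - 1 →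
    ∀ N : ℕ, (freyCurve (-(ℓ : ℤ)) ((ℓ - 1 : ℕ) : ℤ)).conductorNorm ℤ = N →
    ∀ (S : Brandt.XiSetup (N / ℓ) ℓ) [Fintype (Brandt.ClassSet S.O)],
      ∀ φ : Brandt.ClassSet S.O → ℤ, φ ≠ 0 →
        Brandt.eigenLattice (N / ℓ * ℓ) (Brandt.matrix S.O) (aE ℓ) = ℤ ∙ φ →
        ∃ (s : Finset ℕ) (y : ℕ → Brandt.ClassSet S.O → ℤ) (z : Brandt.ClassSet S.O → ℤ),
          (∀ p ∈ s, p.Prime ∧ ¬ p ∣ N / ℓ * ℓ) ∧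
          φ = ∑ p ∈ s, (Brandt.matrix S.O p *ᵥ y p - aE ℓ p • y p)
                + (((2 ^ ((q - 1).factorization 2 - c) : ℕ) : ℤ)) • z

/-- **H5** (one cycle): K_B gives the stub, by H3 with `T := Brandt.matrix S.O`, Eichler's weight symmetry
`Brandt.XiSetup.weight_mul_matrix_symm` (PROVED in the tree) and `Brandt.mem_eigenLattice_iff`. -/
theorem stub_of_freyHeckeBoundaryDepth (h : FreyHeckeBoundaryDepth) : Stub := by
  sorry

/-! ## Plan B/C — norm refinement: the stub at modulus `2^K` only sees `φ mod 2^{K−1}` -/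

/-- **H4** (one cycle): `Σ w_i φ_i²` modulo `2^{k+1}` depends only on `φ` modulo `2^k` (`k ≥ 1`):
`φ_i² − φ'_i² = (φ_i − φ'_i)(φ_i + φ'_i)` and `φ_i + φ'_i ≡ 0 (mod 2)`. -/
theorem wnorm_sub_wnorm_dvd {ι : Type*} [Fintype ι] (w : ι → ℕ) {φ φ' : ι → ℤ} {k : ℕ} (hk : 1 ≤ k)
    (h : ∀ i, (2 : ℤ) ^ k ∣ φ i - φ' i) :
    (2 : ℤ) ^ (k + 1) ∣ ∑ i, (w i : ℤ) * φ i ^ 2 - ∑ i, (w i : ℤ) * φ' i ^ 2 := by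
  sorry

/-- **H4′** (isotropic-lift criterion, one cycle from H4 + `sum_weight_mul_sq_eq_xi`): to get `2^K ∣ ξ_S`
it suffices to exhibit ANY integer vector `φ' ≡ φ (mod 2^{K−1})` — not necessarily an eigenvector — with
`2^K ∣ Σ w_i φ'_i²`; then `forcedPairOccurrence_of_dvd_xi` (p132787) closes the stub at `c + 2`. -/
theorem dvd_xi_of_isotropic_lift {Nplus Nminus : ℕ} (S : Brandt.XiSetup Nplus Nminus) (lam : ℕ → ℤ)
    [Fintype (Brandt.ClassSet S.O)] {φ : Brandt.ClassSet S.O → ℤ} (hφ : φ ≠ 0)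
    (hL : Brandt.eigenLattice (Nplus * Nminus) (Brandt.matrix S.O) lam = ℤ ∙ φ)
    {K : ℕ} (hK : 2 ≤ K) (φ' : Brandt.ClassSet S.O → ℤ)
    (hcong : ∀ i, (2 : ℤ) ^ (K - 1) ∣ φ i - φ' i)
    (hiso : (2 : ℤ) ^ K ∣ ∑ i, (Brandt.weight S.O i : ℤ) * φ' i ^ 2) :
    2 ^ K ∣ S.xi lam := by
  sorry

/-! ## Sanity: the helpers compose to the stub -/

example (hT : takahashi2001_thm_2_3) (hMod : Summit.ABC.ABC.Theses.DefiniteXi.FreyModularity)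
    (hD : ForcedPairDegreeDepthLaw) : Stub := stub_of_degreeDepthLaw hT hMod hD

example (h : FreyHeckeBoundaryDepth) : Stub := stub_of_freyHeckeBoundaryDepth h

end Summit.ABC.ABC.Cruxes.EisensteinQuarantine.ForcedPairDlog.StubIdeas3

end
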